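/- Copyright: the b2b-balaban cell (near-miss cell 7), T⁴-continuum fan-out, lineage t4-ne7b-p1 (node U5c COUNT
member).  Released under the licence of the surrounding project. -/
import Summits.QuantumFields.BalabanUV.T4Continuum.Support.HistoryBankingPedigreeLedger

/-!
# M5-1b (A3c, second brick) — FLOORS: every component-step of a realised structure owns a performed window floor of the
tagged genealogy (owner module of row NE7b, lineage `t4-ne7b-p1` gen 43; re-open object (α), `SCOPE-alpha.md` v2.6,
ruling R-OWNER-43-1 «THE FLAT ANCHOR LEDGER» (e), FLOOR term; PRE-POSITIONING ONLY)

Summits-side support leaf of the T⁴-continuum cell (rung (B)+1 on a FINITE torus only; NOT infinite volume, NOT the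
mass gap, NOT the Clay statement; NOT a proof of the spine estimate NE7b — the cell's OWN estimate, NOT PRINTED, NOT
PROVED).  [folklore] finite sums over the lineage's pedigree skeleton `HistoryAdmissible.PGen` (`toGen`, `Adm`), its
realisation predicate `HistoryRealiseWeak.RealisesW` with row S1b's window theorems (`joinInLife_of_realisesW`: a join
lies inside both partners' BOOKED lives), the dictionary `T4PersistenceDictionary.Gen` (`WF`, `place`, `reach`, `cover`:
every step of a pending life lies in the placed window of one of the genealogy's events), `T4BranchingRecordsGas.relabel`
(`reach_relabel`), the booked tables `T4TaggedShapeBanking.costT` ∕ `T4PrintedShapeBanking.{floorK, wfloor, sz}` and A3b's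
component count `HistoryBankingPedigreeLedger.compSum`; nothing printed is asserted, no `def`, no cite-tagged hypothesis,
zero `sorry`.  B16 = [Balaban1989LargeFieldII] pp. 384–387 under audit; locators only.

WHY (ruling R-OWNER-43-1 (e), journal «RULING R-OWNER-43-1»).  In the flat anchor ledger the horizon-proportional cost of
the dead matter is ONE footprint floor per component per step (`1122^d·u_t·N(t)` after the lag shift, A2), and the END
pays it PER STEP: the structure's tagged genealogy `G = q.2` (any label type `ε` with a shape map `sh : ε → PEv`, its
shape-relabelling being the pedigree's canonical genealogy — `relabel sh G = P.toGen`, the bridge form of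
`HistoryGenBridge.toGen_toPGen`) books, for each of its events, the window floor `E₂R_t^{q′}` on the placed window.  THIS
FILE proves that at every step `t` below the booked reach the NUMBER OF COMPONENTS of the structure at `t` (A3b's
`compSum 1 P t`) is at most the number of events of `G` whose placed window covers `t` (`compSum_one_le_card_cover`) —
by recursion on the pedigree: one component from the last event on, covered by `Gen.cover`; before a join the partners'
component families are covered by the partners' own events (the join lies inside their booked lives —
`joinInLife_of_realisesW`; their event sets are disjoint and keep their placements — `Gen.WF`, `Gen.place_merge`); a
renewal is transparent (`h < reach` of the renewed line — `Gen.WF`; `Gen.place_renew`) — hence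
**`ncomp_mul_floorK_le_costT`**: `N(t)·floorK C K R t ≤ costT sh C K R G t`, and summed over the performed steps of a
structure pending at `K`, **`sum_ncomp_floorK_le_lifeCost`**: `Σ_{t ≤ K} N(t)·floorK t ≤ lifeCost (dictWT sh R C.n₁)
(costT sh C K R) G` — the FLOOR term of the ledger against the bookings, with no display yet (the display
`u_t·Φ ≤ E₂R_t^{q′} = floorK t` enters at the assembly).

WHAT IS *NOT* DONE HERE.  The FEE term (`j·561^d·L_u·u_{j_b}` per birth on its own window floors — the same covering
events, counted with the display), the assembly with A2 ∕ A3b ∕ `HistoryBankingYoungBirth`, and M5-2.  HONEST: bookkeeping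
over the lineage's own ledger; NE7b NOT proved; spine 0∕9.  HONEST DEPENDENCY (cell): continuum YM on T⁴ ⇐ BetaPertH ∧
nine spine estimates (0∕9 proved); BetaPertH ⇐ (D1) ∧ (D4) ∧ CAP+tail.  This file changes none of it.
-/

open Finset
open Literature.MathematicalPhysics.QuantumFieldTheory.Balaban1983to89
open Literature.MathematicalPhysics.QuantumFieldTheory.Balaban1983to89.B13ScaleTransfer
open Literature.MathematicalPhysics.QuantumFieldTheory.Balaban1983to89.B16SProfile
open T4PersistenceDictionary T4PrintedShapeBanking T4TaggedShapeBanking T4BankedInduction T4BranchingRecordsGas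
open Summit.QuantumFields.BalabanUV.T4Continuum.HistoryAdmissible
open Summit.QuantumFields.BalabanUV.T4Continuum.HistoryRealise
open Summit.QuantumFields.BalabanUV.T4Continuum.HistoryRealiseWeak
open Summit.QuantumFields.BalabanUV.T4Continuum.HistoryBankingPedigreeMax
open Summit.QuantumFields.BalabanUV.T4Continuum.HistoryBankingPedigreeLedger

namespace Summit.QuantumFields.BalabanUV.T4Continuum.HistoryBankingFloors

noncomputable section

open scoped Classical

variable {d : ℕ} {ε : Type*} [DecidableEq ε]

/-! ## §1 Covering events are inherited from the parts -/

section Cover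

variable (W : ε → ℕ)

/-- the events of `G` whose placed window covers the step `t` [folklore] -/
theorem mem_coverSet {G : Gen ε} {t : ℕ} {e : ε} :
    e ∈ G.events.filter (fun e => G.place W e ≤ t ∧ t < G.place W e + W e) ↔
      e ∈ G.events ∧ G.place W e ≤ t ∧ t < G.place W e + W e := Finset.mem_filter

/-- **A RENEWAL KEEPS THE OLD LINE'S COVERING EVENTS** (the renewal label is new, `Gen.place_renew`). [folklore] -/
theorem card_cover_le_renew {G : Gen ε} {e : ε} (he : e ∉ G.events) (h t : ℕ) :
    (G.events.filter (fun e' => G.place W e' ≤ t ∧ t < G.place W e' + W e')).card ≤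
      ((Gen.renew G e h).events.filter
        (fun e' => (Gen.renew G e h).place W e' ≤ t ∧ t < (Gen.renew G e h).place W e' + W e')).card := by
  refine Finset.card_le_card fun e' he' => ?_
  rw [Finset.mem_filter] at he' ⊢
  have hne : e' ≠ e := fun hq => he (hq ▸ he'.1)
  refine ⟨by simp [he'.1], ?_⟩
  rw [Gen.place_renew, if_neg hne]
  exact he'.2

/-- **A MERGER KEEPS BOTH PARTNERS' COVERING EVENTS, DISJOINTLY** (the merger label is new, the partners' event sets
are disjoint, `Gen.place_merge`). [folklore] -/
theorem card_cover_le_merge {X Y : Gen ε} {e : ε} (heX : e ∉ X.events) (heY : e ∉ Y.events)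
    (hXY : Disjoint X.events Y.events) (t : ℕ) :
    (X.events.filter (fun e' => X.place W e' ≤ t ∧ t < X.place W e' + W e')).card +
        (Y.events.filter (fun e' => Y.place W e' ≤ t ∧ t < Y.place W e' + W e')).card ≤
      ((Gen.merge X Y e).events.filter
        (fun e' => (Gen.merge X Y e).place W e' ≤ t ∧ t < (Gen.merge X Y e).place W e' + W e')).card := by
  rw [← Finset.card_union_of_disjoint
    (Finset.disjoint_filter_filter hXY)]
  refine Finset.card_le_card fun e' he' => ?_
  rw [Finset.mem_union, Finset.mem_filter, Finset.mem_filter] at he'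
  rw [Finset.mem_filter]
  rcases he' with ⟨hm, hp⟩ | ⟨hm, hp⟩
  · have hne : e' ≠ e := fun hq => heX (hq ▸ hm)
    refine ⟨by simp [hm], ?_⟩
    rw [Gen.place_merge, if_neg hne, if_pos hm]
    exact hp
  · have hne : e' ≠ e := fun hq => heY (hq ▸ hm)
    have hnX : e' ∉ X.events := fun h' => Finset.disjoint_left.1 hXY h' hm
    refine ⟨by simp [hm], ?_⟩
    rw [Gen.place_merge, if_neg hne, if_neg hnX]
    exact hp

end Cover

/-! ## §2 The number of components is at most the number of covering events -/

section Components

variable {L : ℕ} {s R : ℕ → ℕ} (hL : 4 ≤ L) (hdrop : ∀ m, DropCtl s m) (hR : ∀ t, 1 ≤ R t) {n₁ : ℕ}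
  (hn₁ : 13 ≤ n₁) (sh : ε → PEv)
include hL hdrop hR hn₁

omit [DecidableEq ε] hL hdrop hR hn₁ in
/-- the tagged table read through the shape is the dictionary's table of the shape [folklore] -/
theorem reach_relabel_dictWT (G : Gen ε) : (relabel sh G).reach (dictW R n₁) = G.reach (dictWT sh R n₁) :=
  reach_relabel sh (W := dictWT sh R n₁) (W' := dictW R n₁) (fun _ => rfl) G

omit hL hdrop hR hn₁ in
/-- **ONE COMPONENT FROM THE LAST EVENT ON, COVERED** (`Gen.cover`): for `lastStep ≤ t < reach` the single component
is covered by some event's placed window. [folklore] -/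
theorem single_cover {P : PGen (Pt d × Finset (Pt d))} {K' : ℕ} (hA : P.Adm K') {G : Gen ε}
    (hsh : relabel sh G = P.toGen) (hW : G.WF (dictWT sh R n₁)) {t : ℕ} (hlast : P.lastStep ≤ t)
    (ht : t < G.reach (dictWT sh R n₁)) :
    compSum L s (fun _ => (1 : ℝ)) P t ≤
      ((G.events.filter fun e => G.place (dictWT sh R n₁) e ≤ t ∧
          t < G.place (dictWT sh R n₁) e + dictWT sh R n₁ e).card : ℝ) := by
  rw [compSum_of_le P hA hlast]
  have hroot : G.rootStep ≤ t := by
    have h1 : G.rootStep = P.rootStep := by rw [← rootStep_relabel sh G, hsh, PGen.rootStep_toGen]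
    have h2 := HistoryAdmissible.PGen.Adm.rootStep_le_lastStep hA
    omega
  obtain ⟨e, he, h1, h2⟩ := Gen.cover (dictWT sh R n₁) G hW t hroot ht
  have : 1 ≤ (G.events.filter fun e => G.place (dictWT sh R n₁) e ≤ t ∧
      t < G.place (dictWT sh R n₁) e + dictWT sh R n₁ e).card :=
    Finset.card_pos.2 ⟨e, Finset.mem_filter.2 ⟨he, h1, h2⟩⟩
  exact_mod_cast this

/-- **COMPONENTS ≤ COVERING EVENTS.**  For a pedigree `P` realised along a flow with `L ≥ 4`, drop control on every
horizon, sizes `R ≥ 1`, allowance `n₁ ≥ 13`, and a well-formed tagged genealogy `G` whose shape-relabelling is `P`'s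
canonical genealogy: at every step `t` below `G`'s booked reach, the number of components of the structure at `t` is at
most the number of events of `G` whose placed window covers `t`. [folklore] -/
theorem compSum_one_le_card_cover :
    ∀ (P : PGen (Pt d × Finset (Pt d))) (Z : Finset (Pt d)), RealisesW L s R P Z → ∀ (G : Gen ε),
      relabel sh G = P.toGen → G.WF (dictWT sh R n₁) → ∀ {t : ℕ}, t < G.reach (dictWT sh R n₁) →
        compSum L s (fun _ => (1 : ℝ)) P t ≤
          ((G.events.filter fun e => G.place (dictWT sh R n₁) e ≤ t ∧
              t < G.place (dictWT sh R n₁) e + dictWT sh R n₁ e).card : ℝ)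
  | .birth j cls zZ, Z, hP, G, hsh, hW, t, ht => by
      by_cases hlast : j ≤ t
      · exact single_cover sh (adm_of_realisesW _ Z hP le_rfl) hsh hW hlast ht
      · have h0 : compSum L s (fun _ => (1 : ℝ)) (PGen.birth j cls zZ) t = 0 := by
          unfold compSum; rw [if_neg hlast]
        rw [h0]; exact Nat.cast_nonneg _
  | .renew Q h, Z, hP, G, hsh, hW, t, ht => by
      by_cases hlast : h + 1 ≤ t
      · exact single_cover sh (adm_of_realisesW _ Z hP le_rfl) hsh hW hlast ht
      · obtain ⟨G', e, h', rfl⟩ : ∃ G' e h', G = Gen.renew G' e h' := by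
          cases G with
          | born _ _ => simp [PGen.toGen] at hsh
          | renew G' e h' => exact ⟨G', e, h', rfl⟩
          | merge _ _ _ => simp [PGen.toGen] at hsh
        simp only [PGen.toGen, relabel_renew, Gen.renew.injEq] at hsh
        obtain ⟨hshQ, -, hh⟩ := hsh
        subst hh
        simp only [Gen.WF] at hW
        obtain ⟨hW', he, -, hhr⟩ := hW
        obtain ⟨ZQ, hQ, -⟩ := hP
        have ih := compSum_one_le_card_cover Q ZQ hQ G' hshQ hW' (t := t) (by omega)
        have hmono := card_cover_le_renew (dictWT sh R n₁) he h' t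
        have h0 : compSum L s (fun _ => (1 : ℝ)) (PGen.renew Q h') t = compSum L s (fun _ => (1 : ℝ)) Q t := by
          conv_lhs => unfold compSum
        rw [h0]
        exact ih.trans (by exact_mod_cast hmono)
  | .join X Y sj, Z, hP, G, hsh, hW, t, ht => by
      by_cases hlast : sj ≤ t
      · exact single_cover sh (adm_of_realisesW _ Z hP le_rfl) hsh hW hlast ht
      · obtain ⟨GX, GY, e, rfl⟩ : ∃ GX GY e, G = Gen.merge GX GY e := by
          cases G with
          | born _ _ => simp [PGen.toGen] at hsh
          | renew _ _ _ => simp [PGen.toGen] at hsh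
          | merge GX GY e => exact ⟨GX, GY, e, rfl⟩
        simp only [PGen.toGen, relabel_merge, Gen.merge.injEq] at hsh
        obtain ⟨hshX, hshY, -⟩ := hsh
        have hJ := joinInLife_of_realisesW hL hdrop hR hn₁ (PGen.join X Y sj) Z hP
        simp only [PGen.JoinInLife] at hJ
        obtain ⟨-, -, hsX, hsY⟩ := hJ
        rw [← hshX, reach_relabel_dictWT sh GX] at hsX
        rw [← hshY, reach_relabel_dictWT sh GY] at hsY
        simp only [Gen.WF] at hW
        obtain ⟨hWX, hWY, heX, heY, hXY, -, -⟩ := hW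
        obtain ⟨ZX, ZY, hX, hY, -⟩ := hP
        have ihX := compSum_one_le_card_cover X ZX hX GX hshX hWX (t := t) (by omega)
        have ihY := compSum_one_le_card_cover Y ZY hY GY hshY hWY (t := t) (by omega)
        have hmono := card_cover_le_merge (dictWT sh R n₁) heX heY hXY t (e := e)
        have h0 : compSum L s (fun _ => (1 : ℝ)) (PGen.join X Y sj) t =
            compSum L s (fun _ => (1 : ℝ)) X t + compSum L s (fun _ => (1 : ℝ)) Y t := by
          conv_lhs => unfold compSum
          rw [if_neg hlast]
        rw [h0]
        have hm : ((GX.events.filter fun e' => GX.place (dictWT sh R n₁) e' ≤ t ∧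
              t < GX.place (dictWT sh R n₁) e' + dictWT sh R n₁ e').card : ℝ) +
            ((GY.events.filter fun e' => GY.place (dictWT sh R n₁) e' ≤ t ∧
              t < GY.place (dictWT sh R n₁) e' + dictWT sh R n₁ e').card : ℝ) ≤
            (((Gen.merge GX GY e).events.filter fun e' => (Gen.merge GX GY e).place (dictWT sh R n₁) e' ≤ t ∧
              t < (Gen.merge GX GY e).place (dictWT sh R n₁) e' + dictWT sh R n₁ e').card : ℝ) := by
          exact_mod_cast hmono
        linarith

end Components

/-! ## §3 One floor per component-step against the booked cost -/

section Floors

variable {L : ℕ} {s R : ℕ → ℕ} (hL : 4 ≤ L) (hdrop : ∀ m, DropCtl s m) (hR : ∀ t, 1 ≤ R t)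
  (sh : ε → PEv) {C : T4PrintedShapeBanking.Consts} (hn₁ : 13 ≤ C.n₁) (hE₂ : 0 ≤ C.E₂) (hE₃ : 0 ≤ C.E₃) (K : ℕ)
include hL hdrop hR hn₁ hE₂ hE₃

/-- **ONE FLOOR PER COMPONENT PER STEP IS BOOKED**: under the hypotheses of `compSum_one_le_card_cover` (allowance
`C.n₁ ≥ 13`, `E₂, E₃ ≥ 0`), at every step `t` below the booked reach,
`N(t)·floorK C K R t ≤ costT sh C K R G t` — each covering event books the floor on its placed window
(`wfloor_of_mem`), the other summands of `costT` are nonnegative. [folklore] -/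
theorem ncomp_mul_floorK_le_costT {P : PGen (Pt d × Finset (Pt d))} {Z : Finset (Pt d)}
    (hP : RealisesW L s R P Z) {G : Gen ε} (hsh : relabel sh G = P.toGen) (hW : G.WF (dictWT sh R C.n₁)) {t : ℕ}
    (ht : t < G.reach (dictWT sh R C.n₁)) :
    compSum L s (fun _ => (1 : ℝ)) P t * floorK C K R t ≤ costT sh C K R G t := by
  have hcov := compSum_one_le_card_cover hL hdrop hR hn₁ sh P Z hP G hsh hW ht
  have hfl : 0 ≤ floorK C K R t := floorK_nonneg hE₂ t
  set F := G.events.filter fun e => G.place (dictWT sh R C.n₁) e ≤ t ∧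
    t < G.place (dictWT sh R C.n₁) e + dictWT sh R C.n₁ e with hF
  have h1 : (F.card : ℝ) * floorK C K R t = ∑ e ∈ F, wfloor C K R (G.place (dictWT sh R C.n₁) e) (sh e) t := by
    rw [Finset.sum_congr rfl fun e he => wfloor_of_mem (K := K) (by
      rw [hF, Finset.mem_filter] at he
      exact Finset.mem_Ico.2 he.2), Finset.sum_const, nsmul_eq_mul]
  have h2 : ∑ e ∈ F, wfloor C K R (G.place (dictWT sh R C.n₁) e) (sh e) t ≤
      ∑ e ∈ G.events, (wfloor C K R (G.place (dictWT sh R C.n₁) e) (sh e) t + sz C K R (sh e) t) := by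
    calc ∑ e ∈ F, wfloor C K R (G.place (dictWT sh R C.n₁) e) (sh e) t
        ≤ ∑ e ∈ G.events, wfloor C K R (G.place (dictWT sh R C.n₁) e) (sh e) t :=
          Finset.sum_le_sum_of_subset_of_nonneg (Finset.filter_subset _ _)
            fun e _ _ => wfloor_nonneg hE₂ _ _ _
      _ ≤ _ := Finset.sum_le_sum fun e _ => le_add_of_nonneg_right (sz_nonneg hE₃ _ _)
  have h3 : compSum L s (fun _ => (1 : ℝ)) P t * floorK C K R t ≤ (F.card : ℝ) * floorK C K R t :=
    mul_le_mul_of_nonneg_right hcov hfl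
  unfold costT
  linarith

omit hL hdrop hR hn₁ hE₂ hE₃ in
/-- the component count vanishes before the root step (under `Adm`: a join is dated after its partners' roots)
[folklore] -/
theorem compSum_eq_zero_of_lt_rootStep {φ : ℕ → ℝ} :
    ∀ (P : PGen (Pt d × Finset (Pt d))) {K' t : ℕ}, P.Adm K' → t < P.rootStep → compSum L s φ P t = 0
  | .birth j _ _, K', t, _, h => by
      simp only [PGen.rootStep] at h
      unfold compSum; rw [if_neg (by omega)]
  | .renew G _, K', t, hA, h => by
      simp only [PGen.Adm] at hA
      unfold compSum; exact compSum_eq_zero_of_lt_rootStep (φ := φ) G hA.1 h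
  | .join X Y sj, K', t, hA, h => by
      simp only [PGen.Adm] at hA
      simp only [PGen.rootStep, lt_min_iff] at h
      have hX := compSum_eq_zero_of_lt_rootStep (φ := φ) X hA.1 h.1
      have hY := compSum_eq_zero_of_lt_rootStep (φ := φ) Y hA.2.1 h.2
      have hr := HistoryAdmissible.PGen.Adm.rootStep_le_lastStep hA.1
      have hs : ¬ sj ≤ t := by omega
      unfold compSum; rw [if_neg hs, hX, hY, add_zero]

/-- **THE FLOOR TERM OF THE LEDGER AGAINST THE BOOKINGS**: for a structure pending at the cutoff (`K < reach`), summed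
over the performed steps, `Σ_{t ≤ K} N(t)·floorK C K R t ≤ lifeCost (dictWT sh R C.n₁) (costT sh C K R) G` — steps
before the root carry no component, the others lie in the booked life, and `costT ≥ 0`. [folklore] -/
theorem sum_ncomp_floorK_le_lifeCost {P : PGen (Pt d × Finset (Pt d))} {Z : Finset (Pt d)}
    (hP : RealisesW L s R P Z) {G : Gen ε} (hsh : relabel sh G = P.toGen) (hW : G.WF (dictWT sh R C.n₁))
    (hK : K < G.reach (dictWT sh R C.n₁)) :
    ∑ t ∈ Finset.range (K + 1), compSum L s (fun _ => (1 : ℝ)) P t * floorK C K R t ≤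
      lifeCost (dictWT sh R C.n₁) (costT sh C K R) G := by
  have hroot : G.rootStep = P.rootStep := by rw [← rootStep_relabel sh G, hsh, PGen.rootStep_toGen]
  have hA := adm_of_realisesW P Z hP le_rfl
  have hterm : ∀ t ∈ Finset.range (K + 1), compSum L s (fun _ => (1 : ℝ)) P t * floorK C K R t ≤
      if G.rootStep ≤ t then costT sh C K R G t else 0 := by
    intro t htK
    rw [Finset.mem_range] at htK
    split_ifs with hrt
    · exact ncomp_mul_floorK_le_costT hL hdrop hR sh hn₁ hE₂ hE₃ K hP hsh hW (by omega)
    · rw [compSum_eq_zero_of_lt_rootStep P hA (by omega), zero_mul]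
  refine (Finset.sum_le_sum hterm).trans ?_
  rw [← Finset.sum_filter]
  unfold lifeCost life
  refine Finset.sum_le_sum_of_subset_of_nonneg (fun t ht => ?_) fun t _ _ => costT_nonneg hE₂ hE₃ G t
  simp only [Finset.mem_filter, Finset.mem_range] at ht
  rw [Finset.mem_Ico]
  omega

end Floors

end

end Summit.QuantumFields.BalabanUV.T4Continuum.HistoryBankingFloors
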